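import Summits.QuantumFields.YangMills.Theorems.BalabanUVNodesN22W1StripLemma3
import Literature.MathematicalPhysics.QuantumFieldTheory.Balaban1983to89.B13NodeTorusFamilyNonvacuity

/-!
# BalabanUVNodes ∕ node N22 = NE9 — THE STRIP INDUCTION AT THE W1 OBJECT, MODULE 4: THE NUMERALS — the 29 numeric clauses of modules 1–3
# (the socket's printed restrictions `Lemma3Numerics` at `ℓ = ½L`, S25's two located clauses at `A := C₃ε₁`, `R := (1−8δ)½Lκ`, `r₁ := κ`, and
# the amplitude renewal from print's R23) are JOINTLY SATISFIED at the tree's witness constants; the chain end to end at the witness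

Cell `pub-ymgap`, HUMAN RULING D-0062 (Track A), R134 ACCELERATION re-seat `pub-ymgap-dag-n22-c` (strategy s1), generation 2, module 4.  THEOREMS
ONLY; imports module 3 `…N22W1StripLemma3` and the Literature non-vacuity modules `B13Lemma3TorusNonvacuity` (`consts`,
`numerics_nonvacuous_pos_consts`: the 41 printed∕located numeric clauses of [II] pp. 17–21 at the NAMED witness `consts`, L = 8, δ = 3∕40, bond-cube
side 1) and `B13NodeTorusFamilyNonvacuity` (`numerics_consts`: the socket bundle `Lemma3Numerics consts 1 (½L) aw 1 1 ½ 1`) BY NAME.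
`--supports` the K3 item of route `BalabanUVNodes`.

WHY.  Modules 1–3 carry, besides the ONE displayed one-step hypothesis (level T: (2.15)–(2.26) per term read on the strip) and the readings-in-the-
spaces clause, a list of NUMERIC side conditions: the socket's 25-field `Lemma3Numerics c M (½L) a a₂ a₂′ a₅ Aabs` (R15–R18, R20–R21, (2.29)∕(2.31),
the absorption into `C₃ε₁`), `8 ≤ L`, `0 ≤ C₃ε₁`, and S25's clauses read at `A := C₃ε₁`, `R := (1−8δ)½Lκ`, `r₁ ≥ κ`: `r₁ + 2·64·log 162 + 2 ≤ R`,
`C₃ε₁·e^{5r₁+1}·K₀(64,8)·9·64 ≤ 1`, and the renewal `e·9·64·K₀(64,8)²·C₃ε₁ ≤ E₀`.  A referee must be able to see that this list is CONSISTENT (an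
inconsistent list would make every theorem of modules 1–3 vacuous).  The tree already holds a named witness for the printed list together with S25's
two clauses at `r₁ := κ` and print's R23 `A₂C₃ε₁ ≤ ½E₀` with `A₂ ≥ e·9·64·K₀(64,8)²` (`numerics_nonvacuous_pos_consts`, conjuncts 29–36); this module
reads the modules' exact clause list off it (§1), packages the `∃` (§2), and runs the chain of modules 1–3 END TO END AT THE WITNESS (§3), where the
only hypotheses left are the level-T strip hypothesis, the readings-in-the-spaces clause and `0 ≤ r`.

WHAT.
* §1 `stripNumerics_consts` — at `c := consts`, `M := 1`, `ℓ := ½L = 4`, `(a, a₂, a₂′, a₅, Aabs) := (aw, 1, 1, ½, 1)`, `r₁ := κ := consts.κ`, `E₀ :=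
  consts.E₀`: `8 ≤ L ∧ Lemma3Numerics … ∧ 0 ≤ C₃ε₁ ∧ 0 ≤ r₁ ∧ κ ≤ r₁ ∧ r₁ + 2·64·log 162 + 2 ≤ (1−8δ)½Lκ ∧ C₃ε₁e^{5r₁+1}K₀(64,8)·576 ≤ 1 ∧
  e·576·K₀(64,8)²·C₃ε₁ ≤ E₀` (the renewal: `e·576·K₀² ≤ A₂`, R23 `A₂C₃ε₁ ≤ ½E₀`, `0 ≤ E₀`).
* §2 `stripNumerics_nonvacuous` — the `∃`-packaging over `(c, M, L, a, a₂, a₂′, a₅, Aabs, r₁, κ, E₀)`.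
* §3 `termBound118_of_termwise226Strip_consts` ∕ `supLetter_functionalOn_of_termwise226Strip_consts` — modules 1–3 END TO END AT THE WITNESS for towers of
  cube parameter `M = 1` on the record's frame: the level-T strip hypothesis at `(consts, L = 8, aw, a₅ = ½, E₀ = consts.E₀, κ = consts.κ)` (`consts.L = 8` by `consts_L`) + readings in
  the spaces + `0 ≤ r` ⟹ (1.18) one run and ROAD 3's (A) letter `E₀·1^{age}·e^{−κd}`.

HONEST FRAMING.  Count-neutral; a CONSISTENCY WITNESS for the numerals as typed (the witness constants are the tree's, `L = 8`, cube side `1`,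
`E₀ = 2`; they are NOT the record's constants and certify nothing about Bałaban's regime beyond joint satisfiability); the level-T hypothesis stays
DISPLAYED and asserted nowhere (modules 1–3 HONEST FRAMING applies verbatim); NOT a discharge of N22; NE9 NOT IN PRINT, NOT PROVED; one finite four-torus
programme at fixed ε — NOT infinite volume, NOT OS on ℝ⁴, NOT a mass gap, NOT Clay.  0 `sorry`, 0 `def`, standard axioms.

References (TYPES only): [II] = [Balaban1988RG2Cluster] T. Bałaban, Commun. Math. Phys. **116** (1988) 1–22 — pp. 17–21 (restrictions on the
constants), R23 p. 21 («we assume that O(1)C₃ε₁ ≤ ½E₀»), closing paragraph p. 21 («The assumptions allow finally us to fix all the constants»).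
-/

noncomputable section

namespace YMDAG.N22.W1

open Set Metric
open scoped BigOperators
open Literature.MathematicalPhysics.QuantumFieldTheory.Balaban1983to89
open Literature.MathematicalPhysics.QuantumFieldTheory.Balaban1983to89.T4Continuum (T4Family)
open Literature.MathematicalPhysics.QuantumFieldTheory.Balaban1983to89.T4OutputRate
open Literature.MathematicalPhysics.QuantumFieldTheory.Balaban1983to89.TreeLengthTorus (TPt TDom tsys torusTreeLen torusTreeLen_nonneg)
open Literature.MathematicalPhysics.QuantumFieldTheory.Balaban1983to89.B12TreeDecay (K₀ K₀_pos)
open Literature.MathematicalPhysics.QuantumFieldTheory.Balaban1983to89.B13Lemma3TorusData (TBond)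
open Literature.MathematicalPhysics.QuantumFieldTheory.Balaban1983to89.B13Lemma3TorusTerms (terms weight)
open Literature.MathematicalPhysics.QuantumFieldTheory.Balaban1983to89.B13Lemma3TorusSocket (Lemma3Numerics)
open Literature.MathematicalPhysics.QuantumFieldTheory.Balaban1983to89.B13Lemma3WindowNonvacuity (aw)
open Literature.MathematicalPhysics.QuantumFieldTheory.Balaban1983to89.B13Lemma3TorusNonvacuity (consts numerics_nonvacuous_pos_consts consts_L)
open Literature.MathematicalPhysics.QuantumFieldTheory.Balaban1983to89.B13NodeTorusFamilyNonvacuity (numerics_consts)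
open Literature.MathematicalPhysics.QuantumFieldTheory.Balaban1983to89.Node00
open Literature.MathematicalPhysics.QuantumFieldTheory.Balaban1983to89.Node00.Sect2 (domSys domCount CPair ofBackgroundC)
open Literature.MathematicalPhysics.QuantumFieldTheory.Balaban1983to89.Node00.W1

/-! ## §1 The numerals of modules 1–3 at the tree's witness constants -/

/-- **THE 29 NUMERIC CLAUSES OF THE STRIP INDUCTION HOLD AT THE WITNESS** `c := consts` (L = 8, δ = 3∕40, E₀ = 2), bond-cube side `M := 1`, transfer
factor `½L`, rate `aw`, `(a₂, a₂′, a₅, Aabs) := (1, 1, ½, 1)`, S25's rate `r₁ := κ` and the (1.18)-letters `(E₀, κ) := (consts.E₀, consts.κ)`: the socket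
bundle (`numerics_consts`), `8 ≤ L`, `0 ≤ C₃ε₁`, `0 ≤ r₁`, `κ ≤ r₁`, S25's two clauses at `A := C₃ε₁`, `R := (1−8δ)½Lκ` (conjuncts of
`numerics_nonvacuous_pos_consts`), and the renewal `e·9·64·K₀(64,8)²·C₃ε₁ ≤ E₀` (from `e·9·64·K₀² ≤ A₂`, R23 `A₂C₃ε₁ ≤ ½E₀`, `0 ≤ E₀`).
[cite: Balaban1988RG2Cluster, p.21 (R23 and the closing paragraph)] -/
theorem stripNumerics_consts :
    8 ≤ consts.L ∧ Lemma3Numerics consts 1 ((consts.L : ℝ) / 2) aw 1 1 (1 / 2) 1 ∧ 0 ≤ consts.C3act * consts.ε₁ ∧ 0 ≤ consts.κ ∧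
      consts.κ ≤ consts.κ ∧ consts.κ + 2 * (64 * Real.log 162) + 2 ≤ (1 - 8 * consts.δ) * ((consts.L : ℝ) / 2) * consts.κ ∧
      consts.C3act * consts.ε₁ * Real.exp (5 * consts.κ + 1) * K₀ 64 8 * 9 * 64 ≤ 1 ∧
      Real.exp 1 * 9 * 64 * K₀ 64 8 ^ 2 * (consts.C3act * consts.ε₁) ≤ consts.E₀ := by
  obtain ⟨hL, -, -, -, -, -, -, hκ, -, -, -, -, -, -, -, -, -, -, -, -, -, -, -, -, -, -, -, -, hC3pos, hlarge, hsmall, hA₂, -, hR23,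
    -, hE₀, -⟩ := numerics_nonvacuous_pos_consts
  refine ⟨hL, numerics_consts, hC3pos, hκ, le_rfl, hlarge, hsmall, ?_⟩
  have h23 : consts.A₂ * consts.C3act * consts.ε₁ ≤ consts.E₀ / 2 := hR23
  calc Real.exp 1 * 9 * 64 * K₀ 64 8 ^ 2 * (consts.C3act * consts.ε₁)
      ≤ consts.A₂ * (consts.C3act * consts.ε₁) := mul_le_mul_of_nonneg_right hA₂ hC3pos
    _ = consts.A₂ * consts.C3act * consts.ε₁ := by ring
    _ ≤ consts.E₀ := by linarith

/-! ## §2 The `∃`-packaging -/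

/-- **THE NUMERALS OF MODULES 1–3 ARE JOINTLY SATISFIABLE**: there are constants `c`, a bond-cube side `M ≥ 1`, a block factor `L = c.L ≥ 8`, socket
letters `(a, a₂, a₂′, a₅, Aabs)` and (1.18)∕S25 letters `(E₀, κ, r₁)` satisfying every numeric hypothesis of `stepOut_of_termwise226Strip` ∕
`stripBound_termC_of_termwise226Strip` ∕ `termBound118_of_termwise226Strip` ∕ `supLetter_functionalOn_of_termwise226Strip` (module 3) — hence of
modules 1–2 at `A := C₃ε₁`, `R := (1−8δ)½Lκ` — simultaneously (§1's witness).  Consistency of the clause list as typed; nothing about Bałaban's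
regime. [cite: Balaban1988RG2Cluster, p.21 (closing paragraph)] -/
theorem stripNumerics_nonvacuous :
    ∃ (c : B13.Consts) (M L : ℕ) (a a₂ a₂' a₅ Aabs E₀ κ r₁ : ℝ), 0 < M ∧ 0 < L ∧ 8 ≤ c.L ∧ c.L = L ∧
      Lemma3Numerics c M ((c.L : ℝ) / 2) a a₂ a₂' a₅ Aabs ∧ 0 ≤ c.C3act * c.ε₁ ∧ 0 ≤ r₁ ∧ κ ≤ r₁ ∧
      r₁ + 2 * (64 * Real.log 162) + 2 ≤ (1 - 8 * c.δ) * ((c.L : ℝ) / 2) * c.κ ∧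
      c.C3act * c.ε₁ * Real.exp (5 * r₁ + 1) * K₀ 64 8 * 9 * 64 ≤ 1 ∧ Real.exp 1 * 9 * 64 * K₀ 64 8 ^ 2 * (c.C3act * c.ε₁) ≤ E₀ ∧
      κ = c.κ ∧ E₀ = c.E₀ := by
  obtain ⟨hL, hN, hC3pos, hκ, hκr, hlarge, hsmall, hrenew⟩ := stripNumerics_consts
  exact ⟨consts, 1, consts.L, aw, 1, 1, 1 / 2, 1, consts.E₀, consts.κ, consts.κ, Nat.one_pos, by omega, hL, rfl, hN, hC3pos, hκ, hκr,
    hlarge, hsmall, hrenew, rfl, rfl⟩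

/-! ## §3 Modules 1–3 end to end at the witness -/

variable (F : T4Family) (K : ℕ) {𝔸 : Type*}

open Classical in
/-- **(1.18) ONE RUN FROM THE LEVEL-T STRIP HYPOTHESIS ALONE, AT THE WITNESS** (towers of cube parameter `M = 1` on the record's frame; block factor
`L = 8 = consts.L` (`consts_L`); letters `a := aw`, `a₅ := ½`, `E₀ := consts.E₀`, `κ := consts.κ`): module 3's `termBound118_of_termwise226Strip` with every numeric
hypothesis discharged by §1. [cite: Balaban1987RG1, (1.18) p.263] -/
theorem termBound118_of_termwise226Strip_consts (S : ClusterTower (F.P K) 𝔸 1)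
    (sp : (j : ℕ) → (domSys (F.P K) 1 j).Dom → Set (CPair (F.P K) 𝔸)) {γ r : ℝ} (hr : 0 ≤ r)
    (h226T : ∀ (k : ℕ) (g : ℕ → ℝ), g ∈ Window γ → ∀ (i : ℕ), i < k + 1 → ∀ (X : (domSys (F.P K) 1 (k + 1)).Dom) (φ : CPair (F.P K) 𝔸),
      φ ∈ sp (k + 1) X →
      (∀ (j : ℕ), j < k + 1 → ∀ (Y : (domSys (F.P K) 1 j).Dom) (ψ : CPair (F.P K) 𝔸), ψ ∈ sp j Y →
        ∃ (Ec : ℂ → ℂ) (O : Set ℂ), IsOpen O ∧ (∀ t ∈ Ioc (0 : ℝ) γ, closedBall (t : ℂ) r ⊆ O) ∧ DifferentiableOn ℂ Ec O ∧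
          (∀ z ∈ O, ‖Ec z‖ ≤ consts.E₀ * Real.exp (-(consts.κ * torusTreeLen Y.1))) ∧
          (∀ t ∈ Ioc (0 : ℝ) γ, Ec t = termC S j Y (Function.update g i t) ψ)) →
      ∃ (Hc : ℂ → TDom 4 (domCount (F.P K) 1 (k + 1)) → ℂ)
        (Tt : (Z : TDom 4 (domCount (F.P K) 1 (k + 1))) →
          Finset (TDom 4 (8 * domCount (F.P K) 1 (k + 1))) × Finset (TBond 4 1 (8 * domCount (F.P K) 1 (k + 1))) → ℂ → ℂ)
        (O : Set ℂ), IsOpen O ∧ (∀ t ∈ Ioc (0 : ℝ) γ, closedBall (t : ℂ) r ⊆ O) ∧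
        (∀ Z : (domSys (F.P K) 1 (k + 1)).Dom, Z.1 ⊆ X.1 → DifferentiableOn ℂ (fun z => Hc z Z) O) ∧
        (∀ z ∈ O, ∀ Z : TDom 4 (domCount (F.P K) 1 (k + 1)), Z.1 ⊆ X.1 → ‖Hc z Z‖ ≤ ∑ t ∈ terms 8 1 Z, ‖Tt Z t z‖) ∧
        (∀ z ∈ O, ∀ Z : TDom 4 (domCount (F.P K) 1 (k + 1)), Z.1 ⊆ X.1 → ∀ t ∈ terms 8 1 Z,
          ‖Tt Z t z‖ ≤ weight 8 1 consts Z aw t * Real.exp (1 / 2 * ((Z.1).card : ℝ))) ∧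
        (∀ t ∈ Ioc (0 : ℝ) γ, Hc t = (S k).H (restrictPrefix k (Function.update g i t)) φ)) :
    TermBound118 S (Window γ) sp consts.E₀ consts.κ := by
  obtain ⟨hL, hN, hC3pos, hκ, hκr, hlarge, hsmall, hrenew⟩ := stripNumerics_consts
  exact termBound118_of_termwise226Strip F K S sp consts hL consts_L hN hr hC3pos hκ hκr hlarge hsmall hrenew h226T

open Classical in
/-- **ROAD 3's (A) LETTER FROM THE LEVEL-T STRIP HYPOTHESIS ALONE, AT THE WITNESS** (towers of cube parameter `M = 1`; readings inside the spaces):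
module 3's `supLetter_functionalOn_of_termwise226Strip` with every numeric hypothesis discharged by §1 — the `hA` clause of
`YMDAG.N22.n22At_of_oscAnalytic` with `M := consts.E₀`, `μ := 1`, `κ := consts.κ`. [folklore] -/
theorem supLetter_functionalOn_of_termwise226Strip_consts (S : ClusterTower (F.P K) 𝔸 1) (p : RunPairing) {B : Type}
    (emb : B → CPair (F.P K) 𝔸) (sp : (j : ℕ) → (domSys (F.P K) 1 j).Dom → Set (CPair (F.P K) 𝔸))
    (hsp : ∀ (j : ℕ) (U : B) (Y : (domSys (F.P K) 1 j).Dom), emb U ∈ sp j Y) {γ r : ℝ} (hr : 0 ≤ r)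
    (h226T : ∀ (k : ℕ) (g : ℕ → ℝ), g ∈ Window γ → ∀ (i : ℕ), i < k + 1 → ∀ (X : (domSys (F.P K) 1 (k + 1)).Dom) (φ : CPair (F.P K) 𝔸),
      φ ∈ sp (k + 1) X →
      (∀ (j : ℕ), j < k + 1 → ∀ (Y : (domSys (F.P K) 1 j).Dom) (ψ : CPair (F.P K) 𝔸), ψ ∈ sp j Y →
        ∃ (Ec : ℂ → ℂ) (O : Set ℂ), IsOpen O ∧ (∀ t ∈ Ioc (0 : ℝ) γ, closedBall (t : ℂ) r ⊆ O) ∧ DifferentiableOn ℂ Ec O ∧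
          (∀ z ∈ O, ‖Ec z‖ ≤ consts.E₀ * Real.exp (-(consts.κ * torusTreeLen Y.1))) ∧
          (∀ t ∈ Ioc (0 : ℝ) γ, Ec t = termC S j Y (Function.update g i t) ψ)) →
      ∃ (Hc : ℂ → TDom 4 (domCount (F.P K) 1 (k + 1)) → ℂ)
        (Tt : (Z : TDom 4 (domCount (F.P K) 1 (k + 1))) →
          Finset (TDom 4 (8 * domCount (F.P K) 1 (k + 1))) × Finset (TBond 4 1 (8 * domCount (F.P K) 1 (k + 1))) → ℂ → ℂ)
        (O : Set ℂ), IsOpen O ∧ (∀ t ∈ Ioc (0 : ℝ) γ, closedBall (t : ℂ) r ⊆ O) ∧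
        (∀ Z : (domSys (F.P K) 1 (k + 1)).Dom, Z.1 ⊆ X.1 → DifferentiableOn ℂ (fun z => Hc z Z) O) ∧
        (∀ z ∈ O, ∀ Z : TDom 4 (domCount (F.P K) 1 (k + 1)), Z.1 ⊆ X.1 → ‖Hc z Z‖ ≤ ∑ t ∈ terms 8 1 Z, ‖Tt Z t z‖) ∧
        (∀ z ∈ O, ∀ Z : TDom 4 (domCount (F.P K) 1 (k + 1)), Z.1 ⊆ X.1 → ∀ t ∈ terms 8 1 Z,
          ‖Tt Z t z‖ ≤ weight 8 1 consts Z aw t * Real.exp (1 / 2 * ((Z.1).card : ℝ))) ∧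
        (∀ t ∈ Ioc (0 : ℝ) γ, Hc t = (S k).H (restrictPrefix k (Function.update g i t)) φ)) :
    ∀ g ∈ Window γ, ∀ (U : B) (X : (histCarriers (F.P K) 1 p).Dom) (i : ℕ), i < (histCarriers (F.P K) 1 p).scale X →
      ∃ (Fz : ℂ → ℂ) (Dset : Set ℂ), DifferentiableOn ℂ Fz Dset ∧
        (∀ z ∈ Dset, ‖Fz z‖ ≤ consts.E₀ * 1 ^ ((histCarriers (F.P K) 1 p).scale X - 1 - i) *
          Real.exp (-(consts.κ * (histCarriers (F.P K) 1 p).d X))) ∧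
        (∀ t ∈ Ioc (0 : ℝ) γ, closedBall (t : ℂ) r ⊆ Dset) ∧
        (∀ t ∈ Ioc (0 : ℝ) γ, Fz t = (functionalOn S p emb (Function.update g i t) U X : ℂ)) := by
  obtain ⟨hL, hN, hC3pos, hκ, hκr, hlarge, hsmall, hrenew⟩ := stripNumerics_consts
  exact supLetter_functionalOn_of_termwise226Strip F K S p emb sp hsp consts hL consts_L hN hr hC3pos hκ hκr hlarge hsmall hrenew h226T

end YMDAG.N22.W1

end
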